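import Summits.MatrixMultiplication.MatrixMultiplication.Theorems.ObstructionDescentTorusLaws
import Literature.Combinatorics.Enumerative.StirlingFirstKindPermutationCycles

set_option linter.dupNamespace false

/-!
# Trace diagrams: the stabiliser-invariant equations of border-rank type and their values at `⟨n,n,n⟩`
(decomp-mm · lens 3 · gen 19 kernel)

Route `route-MatrixMultiplication-ObstructionDescent` (sub-problem `MatrixMultiplication`, `ω(ℂ) = 2`), degree axis
`E = NoPolyDegreeObstruction` (item `stmt-MatrixMultiplication-30889`) in its CORNER form (`ObstructionDescentCornerEquations`:
equations of `σ_m((ℂ^{n×n})^{⊗3})` of degree `≤ m^c` are zero AT the fixed tensor `⟨n,n,n⟩`).  This module is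
route-independent (it imports only the landed torus laws, for the set `RV` of equations of border-rank type) and def-free.

THE THIRD LANGUAGE.  The connected stabiliser of `⟨n,n,n⟩ = Σ e_{κν} ⊗ e_{κμ} ⊗ e_{μν}` is the image `H_n` of
`GL_n × GL_n × GL_n` (one factor per shared index `κ, μ, ν`; [LandsbergGCT2017, Prop. 4.1.3.1]).  By the first fundamental
theorem for `GL_n` the `H_n`-invariant polynomials of degree `d` on the corner format are spanned by the TRACE DIAGRAMS
`Tr_σ`, `σ = (σ_κ, σ_μ, σ_ν) ∈ (S_d)³`: contract, across the `d` copies of the variable tensor, the `κ`-index of slot `A`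
of copy `σ_κ(s)` with the `κ`-index of slot `B` of copy `s`, and similarly for `μ` (slots `B`, `C`) and `ν` (slots `A`, `C`)
— in coordinates
  `Tr_σ = Σ_{κ μ ν : [d] → [n]} Π_{s} x_{(κ s, ν s), (κ (σ_κ s), μ s), (μ (σ_μ s), ν (σ_ν s))}`
(on a rank-one point `a ⊗ b ⊗ c`, `a, b, c ∈ Mat_n`, this is a product of traces of the cyclic words `abcabc…` read along
the cycles of `σ_ν σ_μ σ_κ`: the invariant theory of the quiver `• ⇉ • ⇉ • ⇉ •` with `m` arrows per edge,
[Lebruyn2008, §1 (p. 39), Thm 1.6 (p. 100)]).  Since `⟨n,n,n⟩` is `H_n`-fixed and `H_n` is reductive, the Reynolds operator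
shows that an equation of `σ_m` is non-zero at `⟨n,n,n⟩` only if an `H_n`-INVARIANT equation of the same degree is
([LandsbergGCT2017, §8.3]; print fact, not used below): `E` is equivalently a statement about LINEAR RELATIONS AMONG TRACE
DIAGRAMS VALID ON `σ_m` («trace identities of border rank `≤ m`»).

PROVED HERE (0 sorry):
* §1 `aeval_traceDiagram` — the value of `Tr_σ` at any tensor; `totalDegree_traceDiagram_le` — `deg Tr_σ ≤ d`.
* §2 THE CYCLE FORMULA `aeval_matMul_traceDiagram`: the value of `Tr_σ` at `⟨n,n,n⟩` is the positive integer
  `#{κ ∘ σ_κ = κ} · #{μ ∘ σ_μ = μ} · #{ν ∘ σ_ν = ν}`, and (`card_filter_comp_perm_eq_pow`) each factor is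
  `n ^ (#fixed points + #cycles)` — so `Tr_σ(⟨n,n,n⟩) = n^{cyc σ_κ + cyc σ_μ + cyc σ_ν} ≥ 1`: NO single trace diagram
  vanishes at `⟨n,n,n⟩` (`aeval_matMul_traceDiagram_ne_zero`); only RELATIONS `Σ c_σ Tr_σ ∈ I(σ_m)` can be obstructions, and
  their value is the CYCLE-GENERATING NUMBER `Σ_σ c_σ n^{cyc σ}` (`aeval_matMul_traceRelation`).
* §3 the cell-wise reading for equations of border-rank type (`traceRelation_blind_of_cornerCell`): whatever kills all
  corner equations of degree `≤ D` at `⟨n,n,n⟩` kills every trace relation of degree `d ≤ D`.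

[cite: LandsbergGCT2017, Prop. 4.1.3.1, §8.3.2 (p. 226); Lebruyn2008, p. 39, p. 100; BurgisserIkenmeyer2011, §3.1]
-/

noncomputable section

open scoped BigOperators
open Finset

namespace Summit.MatrixMultiplication.MatrixMultiplication.Theorems.ObstructionDescentTraceDiagrams

open Literature.Computability.AlgebraicComplexity (tensorRank matMulTensor)
open Summit.MatrixMultiplication.MatrixMultiplication.Theorems.ObstructionDescentTorusLaws

variable {n d : ℕ}

/-! ## §1 Trace diagrams as polynomials on the corner format -/

/-- The value of the trace diagram `Tr_σ` at an arbitrary tensor of the corner format `(ℂ^{n×n})^{⊗3}`. [bookkeeping] -/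
theorem aeval_traceDiagram (t : (Fin n × Fin n) → (Fin n × Fin n) → (Fin n × Fin n) → ℂ)
    (σ : Equiv.Perm (Fin d) × Equiv.Perm (Fin d) × Equiv.Perm (Fin d)) :
    MvPolynomial.aeval (fun p : (Fin n × Fin n) × (Fin n × Fin n) × (Fin n × Fin n) => t p.1 p.2.1 p.2.2)
      (∑ κ : Fin d → Fin n, ∑ μ : Fin d → Fin n, ∑ ν : Fin d → Fin n,
        ∏ s : Fin d, MvPolynomial.X (R := ℂ) ((κ s, ν s), (κ (σ.1 s), μ s), (μ (σ.2.1 s), ν (σ.2.2 s))))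
    = ∑ κ : Fin d → Fin n, ∑ μ : Fin d → Fin n, ∑ ν : Fin d → Fin n,
        ∏ s : Fin d, t (κ s, ν s) (κ (σ.1 s), μ s) (μ (σ.2.1 s), ν (σ.2.2 s)) := by
  simp only [map_sum, map_prod, MvPolynomial.aeval_X]

/-- `deg Tr_σ ≤ d` (in fact `Tr_σ` is homogeneous of degree `d`). [bookkeeping] -/
theorem totalDegree_traceDiagram_le (σ : Equiv.Perm (Fin d) × Equiv.Perm (Fin d) × Equiv.Perm (Fin d)) :
    (∑ κ : Fin d → Fin n, ∑ μ : Fin d → Fin n, ∑ ν : Fin d → Fin n,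
        ∏ s : Fin d, MvPolynomial.X (R := ℂ)
          (((κ s, ν s), (κ (σ.1 s), μ s), (μ (σ.2.1 s), ν (σ.2.2 s))) :
            (Fin n × Fin n) × (Fin n × Fin n) × (Fin n × Fin n))).totalDegree ≤ d := by
  refine MvPolynomial.totalDegree_finsetSum_le fun κ _ => ?_
  refine MvPolynomial.totalDegree_finsetSum_le fun μ _ => ?_
  refine MvPolynomial.totalDegree_finsetSum_le fun ν _ => ?_
  refine (MvPolynomial.totalDegree_finsetProd _ _).trans ?_
  calc ∑ s : Fin d, (MvPolynomial.X (R := ℂ)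
          (((κ s, ν s), (κ (σ.1 s), μ s), (μ (σ.2.1 s), ν (σ.2.2 s))) :
            (Fin n × Fin n) × (Fin n × Fin n) × (Fin n × Fin n))).totalDegree
      ≤ ∑ _s : Fin d, 1 := Finset.sum_le_sum fun s _ => (MvPolynomial.totalDegree_X _).le
    _ = d := by simp

/-- A trace RELATION `Σ_{σ ∈ S} c_σ Tr_σ` has degree `≤ d`. [bookkeeping] -/
theorem totalDegree_traceRelation_le (S : Finset (Equiv.Perm (Fin d) × Equiv.Perm (Fin d) × Equiv.Perm (Fin d)))
    (c : Equiv.Perm (Fin d) × Equiv.Perm (Fin d) × Equiv.Perm (Fin d) → ℂ) :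
    (∑ σ ∈ S, c σ • ∑ κ : Fin d → Fin n, ∑ μ : Fin d → Fin n, ∑ ν : Fin d → Fin n,
        ∏ s : Fin d, MvPolynomial.X (R := ℂ)
          (((κ s, ν s), (κ (σ.1 s), μ s), (μ (σ.2.1 s), ν (σ.2.2 s))) :
            (Fin n × Fin n) × (Fin n × Fin n) × (Fin n × Fin n))).totalDegree ≤ d := by
  refine MvPolynomial.totalDegree_finsetSum_le fun σ _ => ?_
  exact (MvPolynomial.totalDegree_smul_le _ _).trans (totalDegree_traceDiagram_le σ)

/-- The value of a trace relation at an arbitrary tensor: `(Σ c_σ Tr_σ)(t) = Σ_σ c_σ · Tr_σ(t)`. [bookkeeping] -/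
theorem aeval_traceRelation (t : (Fin n × Fin n) → (Fin n × Fin n) → (Fin n × Fin n) → ℂ)
    (S : Finset (Equiv.Perm (Fin d) × Equiv.Perm (Fin d) × Equiv.Perm (Fin d)))
    (c : Equiv.Perm (Fin d) × Equiv.Perm (Fin d) × Equiv.Perm (Fin d) → ℂ) :
    MvPolynomial.aeval (fun p : (Fin n × Fin n) × (Fin n × Fin n) × (Fin n × Fin n) => t p.1 p.2.1 p.2.2)
      (∑ σ ∈ S, c σ • ∑ κ : Fin d → Fin n, ∑ μ : Fin d → Fin n, ∑ ν : Fin d → Fin n,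
        ∏ s : Fin d, MvPolynomial.X (R := ℂ)
          (((κ s, ν s), (κ (σ.1 s), μ s), (μ (σ.2.1 s), ν (σ.2.2 s))) :
            (Fin n × Fin n) × (Fin n × Fin n) × (Fin n × Fin n)))
    = ∑ σ ∈ S, c σ * ∑ κ : Fin d → Fin n, ∑ μ : Fin d → Fin n, ∑ ν : Fin d → Fin n,
        ∏ s : Fin d, t (κ s, ν s) (κ (σ.1 s), μ s) (μ (σ.2.1 s), ν (σ.2.2 s)) := by
  rw [map_sum]
  refine Finset.sum_congr rfl fun σ _ => ?_
  rw [map_smul, aeval_traceDiagram, smul_eq_mul]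

/-- A trace relation that vanishes on all tensors of rank `≤ m` is an equation of border-rank type (`∈ RV`). [bookkeeping] -/
theorem traceRelation_mem_RV {m : ℕ} (S : Finset (Equiv.Perm (Fin d) × Equiv.Perm (Fin d) × Equiv.Perm (Fin d)))
    (c : Equiv.Perm (Fin d) × Equiv.Perm (Fin d) × Equiv.Perm (Fin d) → ℂ)
    (hS : ∀ t : (Fin n × Fin n) → (Fin n × Fin n) → (Fin n × Fin n) → ℂ, tensorRank t ≤ m →
      ∑ σ ∈ S, c σ * ∑ κ : Fin d → Fin n, ∑ μ : Fin d → Fin n, ∑ ν : Fin d → Fin n,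
        ∏ s : Fin d, t (κ s, ν s) (κ (σ.1 s), μ s) (μ (σ.2.1 s), ν (σ.2.2 s)) = 0) :
    (∑ σ ∈ S, c σ • ∑ κ : Fin d → Fin n, ∑ μ : Fin d → Fin n, ∑ ν : Fin d → Fin n,
        ∏ s : Fin d, MvPolynomial.X (R := ℂ)
          (((κ s, ν s), (κ (σ.1 s), μ s), (μ (σ.2.1 s), ν (σ.2.2 s))) :
            (Fin n × Fin n) × (Fin n × Fin n) × (Fin n × Fin n)))
      ∈ RV (Fin n × Fin n) (Fin n × Fin n) (Fin n × Fin n) m := by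
  refine mem_RV.2 fun t ht => ?_
  rw [aeval_traceRelation]
  exact hS t ht

/-! ## §2 The cycle formula: values at `⟨n,n,n⟩` -/

/-- One copy of the variable tensor, evaluated at `⟨n,n,n⟩`: the three linking conditions. [bookkeeping] -/
theorem matMulTensor_link (κ μ ν : Fin d → Fin n)
    (σ : Equiv.Perm (Fin d) × Equiv.Perm (Fin d) × Equiv.Perm (Fin d)) (s : Fin d) :
    matMulTensor ℂ n n n (κ s, ν s) (κ (σ.1 s), μ s) (μ (σ.2.1 s), ν (σ.2.2 s)) =
      if κ s = κ (σ.1 s) ∧ μ s = μ (σ.2.1 s) ∧ ν s = ν (σ.2.2 s) then 1 else 0 := by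
  simp [matMulTensor]

/-- THE CYCLE FORMULA (counting form).  The value of the trace diagram `Tr_σ` at `⟨n,n,n⟩` is the number of triples of
colourings `κ, μ, ν : [d] → [n]` constant along `σ_κ`, `σ_μ`, `σ_ν` respectively — a product of three counts.
[cite: Lebruyn2008, p. 39; LandsbergGCT2017, Prop. 4.1.3.1] -/
theorem aeval_matMul_traceDiagram (σ : Equiv.Perm (Fin d) × Equiv.Perm (Fin d) × Equiv.Perm (Fin d)) :
    MvPolynomial.aeval
        (fun p : (Fin n × Fin n) × (Fin n × Fin n) × (Fin n × Fin n) => matMulTensor ℂ n n n p.1 p.2.1 p.2.2)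
      (∑ κ : Fin d → Fin n, ∑ μ : Fin d → Fin n, ∑ ν : Fin d → Fin n,
        ∏ s : Fin d, MvPolynomial.X (R := ℂ) ((κ s, ν s), (κ (σ.1 s), μ s), (μ (σ.2.1 s), ν (σ.2.2 s))))
    = (((univ.filter fun κ : Fin d → Fin n => ∀ s, κ (σ.1 s) = κ s).card *
        (univ.filter fun μ : Fin d → Fin n => ∀ s, μ (σ.2.1 s) = μ s).card *
        (univ.filter fun ν : Fin d → Fin n => ∀ s, ν (σ.2.2 s) = ν s).card : ℕ) : ℂ) := by
  rw [aeval_traceDiagram]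
  have key : ∀ κ μ ν : Fin d → Fin n,
      (∏ s : Fin d, matMulTensor ℂ n n n (κ s, ν s) (κ (σ.1 s), μ s) (μ (σ.2.1 s), ν (σ.2.2 s))) =
        (if (∀ s, κ (σ.1 s) = κ s) then (1 : ℂ) else 0) *
          ((if (∀ s, μ (σ.2.1 s) = μ s) then (1 : ℂ) else 0) * (if (∀ s, ν (σ.2.2 s) = ν s) then (1 : ℂ) else 0)) := by
    intro κ μ ν
    simp only [matMulTensor_link, Finset.prod_boole, Finset.mem_univ, true_implies, ite_zero_mul_ite_zero, one_mul]
    congr 1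
    simp only [forall_and, eq_iff_iff]
    constructor
    · rintro ⟨h₁, h₂, h₃⟩; exact ⟨fun s => (h₁ s).symm, fun s => (h₂ s).symm, fun s => (h₃ s).symm⟩
    · rintro ⟨h₁, h₂, h₃⟩; exact ⟨fun s => (h₁ s).symm, fun s => (h₂ s).symm, fun s => (h₃ s).symm⟩
  simp_rw [key, ← Finset.mul_sum, ← Finset.sum_mul, Finset.sum_boole]
  push_cast
  ring

/-- The constant colourings are constant along every permutation: each count is positive once `0 < n`. [bookkeeping] -/
theorem card_filter_comp_perm_pos (hn : 0 < n) (π : Equiv.Perm (Fin d)) :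
    0 < (univ.filter fun κ : Fin d → Fin n => ∀ s, κ (π s) = κ s).card := by
  refine Finset.card_pos.mpr ⟨fun _ => ⟨0, hn⟩, ?_⟩
  simp

/-- NO SINGLE TRACE DIAGRAM VANISHES AT `⟨n,n,n⟩` (`n ≥ 1`): its value there is a positive integer.  Hence an
`H_n`-invariant obstruction is never a diagram but a RELATION among diagrams. [cite: LandsbergGCT2017, §8.3.2 (p. 226)] -/
theorem aeval_matMul_traceDiagram_ne_zero (hn : 0 < n)
    (σ : Equiv.Perm (Fin d) × Equiv.Perm (Fin d) × Equiv.Perm (Fin d)) :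
    MvPolynomial.aeval
        (fun p : (Fin n × Fin n) × (Fin n × Fin n) × (Fin n × Fin n) => matMulTensor ℂ n n n p.1 p.2.1 p.2.2)
      (∑ κ : Fin d → Fin n, ∑ μ : Fin d → Fin n, ∑ ν : Fin d → Fin n,
        ∏ s : Fin d, MvPolynomial.X (R := ℂ) ((κ s, ν s), (κ (σ.1 s), μ s), (μ (σ.2.1 s), ν (σ.2.2 s))))
      ≠ 0 := by
  rw [aeval_matMul_traceDiagram]
  have h₁ := card_filter_comp_perm_pos hn σ.1
  have h₂ := card_filter_comp_perm_pos hn σ.2.1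
  have h₃ := card_filter_comp_perm_pos hn σ.2.2
  exact_mod_cast (Nat.mul_pos (Nat.mul_pos h₁ h₂) h₃).ne'

/-- The value at `⟨n,n,n⟩` of a trace RELATION `Σ_{σ ∈ S} c_σ Tr_σ` is its cycle-generating number
`Σ_σ c_σ · #{κ ∘ σ_κ = κ} · #{μ ∘ σ_μ = μ} · #{ν ∘ σ_ν = ν}`. [bookkeeping] -/
theorem aeval_matMul_traceRelation (S : Finset (Equiv.Perm (Fin d) × Equiv.Perm (Fin d) × Equiv.Perm (Fin d)))
    (c : Equiv.Perm (Fin d) × Equiv.Perm (Fin d) × Equiv.Perm (Fin d) → ℂ) :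
    MvPolynomial.aeval
        (fun p : (Fin n × Fin n) × (Fin n × Fin n) × (Fin n × Fin n) => matMulTensor ℂ n n n p.1 p.2.1 p.2.2)
      (∑ σ ∈ S, c σ • ∑ κ : Fin d → Fin n, ∑ μ : Fin d → Fin n, ∑ ν : Fin d → Fin n,
        ∏ s : Fin d, MvPolynomial.X (R := ℂ)
          (((κ s, ν s), (κ (σ.1 s), μ s), (μ (σ.2.1 s), ν (σ.2.2 s))) :
            (Fin n × Fin n) × (Fin n × Fin n) × (Fin n × Fin n)))
    = ∑ σ ∈ S, c σ * (((univ.filter fun κ : Fin d → Fin n => ∀ s, κ (σ.1 s) = κ s).card *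
        (univ.filter fun μ : Fin d → Fin n => ∀ s, μ (σ.2.1 s) = μ s).card *
        (univ.filter fun ν : Fin d → Fin n => ∀ s, ν (σ.2.2 s) = ν s).card : ℕ) : ℂ) := by
  rw [map_sum]
  refine Finset.sum_congr rfl fun σ _ => ?_
  rw [map_smul, aeval_matMul_traceDiagram, smul_eq_mul]

/-! ## §2b The cycle formula proper: each count is `n ^ (number of cycles, fixed points counted)` -/

section CycleFormula

open Equiv Equiv.Perm
open Literature.Combinatorics.Enumerative (natCard_quotient_sameCycle_eq_card_cycleFactorsFinset_add_card_fixed)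

variable {α β : Type*}

/-- A colouring constant along `π` is constant along every power of `π`. [bookkeeping] -/
theorem apply_zpow_apply_of_comp_perm {κ : α → β} {π : Perm α} (h : ∀ s, κ (π s) = κ s) (i : ℤ) (x : α) :
    κ ((π ^ i) x) = κ x := by
  have hn : ∀ (k : ℕ) (x : α), κ ((π ^ k) x) = κ x := by
    intro k
    induction k with
    | zero => intro x; simp
    | succ k ih => intro x; rw [pow_succ', Perm.mul_apply, h, ih]
  obtain ⟨k, rfl | rfl⟩ := Int.eq_nat_or_neg i
  · rw [zpow_natCast]; exact hn k x
  · rw [zpow_neg, zpow_natCast]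
    have hy := hn k ((π ^ k)⁻¹ x)
    rw [Perm.inv_def, Equiv.apply_symm_apply] at hy
    exact hy.symm

variable [Fintype β] [DecidableEq β]

/-- THE CYCLE COUNT.  The colourings `κ : [d] → β` constant along a permutation `π ∈ S_d` are the functions on its `SameCycle`
classes, so their number is `|β| ^ (#cycles of π + #fixed points of π)` (the number of cycles of `π`, fixed points counted
as `1`-cycles). [cite: Lebruyn2008, p. 39] -/
theorem card_filter_comp_perm_eq_pow {d : ℕ} (π : Perm (Fin d)) :
    (univ.filter fun κ : Fin d → β => ∀ s, κ (π s) = κ s).card =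
      Fintype.card β ^ (π.cycleFactorsFinset.card + (univ.filter fun x : Fin d => π x = x).card) := by
  rw [← natCard_quotient_sameCycle_eq_card_cycleFactorsFinset_add_card_fixed, ← Fintype.card_subtype,
    ← Nat.card_eq_fintype_card, ← Nat.card_eq_fintype_card (α := β), ← Nat.card_fun]
  refine Nat.card_congr ?_
  exact
    { toFun := fun κ => Quotient.lift κ.1 fun x y (hxy : SameCycle π x y) => by
        obtain ⟨i, rfl⟩ := hxy
        exact (apply_zpow_apply_of_comp_perm κ.2 i x).symm
      invFun := fun g => ⟨fun x => g (Quotient.mk (SameCycle.setoid π) x), fun s => by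
        show g _ = g _
        congr 1
        exact Quotient.sound (sameCycle_apply_left.2 (SameCycle.refl π s))⟩
      left_inv := fun κ => Subtype.ext (funext fun x => rfl)
      right_inv := fun g => funext fun q => Quotient.inductionOn q fun x => rfl }

end CycleFormula

/-- THE CYCLE FORMULA.  `Tr_σ(⟨n,n,n⟩) = n ^ (cyc σ_κ + cyc σ_μ + cyc σ_ν)`, where `cyc π` is the number of cycles of `π`
with fixed points counted (`#π.cycleFactorsFinset + #{x | π x = x}`): the values of trace diagrams at the matrix
multiplication tensors are MONOMIALS IN `n`, so the value of a trace relation `Σ c_σ Tr_σ` at `⟨n,n,n⟩` is the integer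
polynomial `P_c(z) = Σ_σ c_σ z^{cyc σ}` evaluated at `z = n`. [cite: Lebruyn2008, p. 39, p. 100; LandsbergGCT2017, Prop. 4.1.3.1] -/
theorem aeval_matMul_traceDiagram_eq_pow (σ : Equiv.Perm (Fin d) × Equiv.Perm (Fin d) × Equiv.Perm (Fin d)) :
    MvPolynomial.aeval
        (fun p : (Fin n × Fin n) × (Fin n × Fin n) × (Fin n × Fin n) => matMulTensor ℂ n n n p.1 p.2.1 p.2.2)
      (∑ κ : Fin d → Fin n, ∑ μ : Fin d → Fin n, ∑ ν : Fin d → Fin n,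
        ∏ s : Fin d, MvPolynomial.X (R := ℂ) ((κ s, ν s), (κ (σ.1 s), μ s), (μ (σ.2.1 s), ν (σ.2.2 s))))
    = (n : ℂ) ^ ((σ.1.cycleFactorsFinset.card + (univ.filter fun x : Fin d => σ.1 x = x).card) +
        (σ.2.1.cycleFactorsFinset.card + (univ.filter fun x : Fin d => σ.2.1 x = x).card) +
        (σ.2.2.cycleFactorsFinset.card + (univ.filter fun x : Fin d => σ.2.2 x = x).card)) := by
  rw [aeval_matMul_traceDiagram, card_filter_comp_perm_eq_pow, card_filter_comp_perm_eq_pow, card_filter_comp_perm_eq_pow,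
    Fintype.card_fin]
  push_cast
  ring

/-- The cycle-generating number of a trace relation: `(Σ c_σ Tr_σ)(⟨n,n,n⟩) = Σ_σ c_σ · n^{cyc σ}`. [bookkeeping] -/
theorem aeval_matMul_traceRelation_eq_sum_pow
    (S : Finset (Equiv.Perm (Fin d) × Equiv.Perm (Fin d) × Equiv.Perm (Fin d)))
    (c : Equiv.Perm (Fin d) × Equiv.Perm (Fin d) × Equiv.Perm (Fin d) → ℂ) :
    MvPolynomial.aeval
        (fun p : (Fin n × Fin n) × (Fin n × Fin n) × (Fin n × Fin n) => matMulTensor ℂ n n n p.1 p.2.1 p.2.2)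
      (∑ σ ∈ S, c σ • ∑ κ : Fin d → Fin n, ∑ μ : Fin d → Fin n, ∑ ν : Fin d → Fin n,
        ∏ s : Fin d, MvPolynomial.X (R := ℂ)
          (((κ s, ν s), (κ (σ.1 s), μ s), (μ (σ.2.1 s), ν (σ.2.2 s))) :
            (Fin n × Fin n) × (Fin n × Fin n) × (Fin n × Fin n)))
    = ∑ σ ∈ S, c σ * (n : ℂ) ^ ((σ.1.cycleFactorsFinset.card + (univ.filter fun x : Fin d => σ.1 x = x).card) +
        (σ.2.1.cycleFactorsFinset.card + (univ.filter fun x : Fin d => σ.2.1 x = x).card) +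
        (σ.2.2.cycleFactorsFinset.card + (univ.filter fun x : Fin d => σ.2.2 x = x).card)) := by
  rw [map_sum]
  refine Finset.sum_congr rfl fun σ _ => ?_
  rw [map_smul, aeval_matMul_traceDiagram_eq_pow, smul_eq_mul]

/-! ## §3 Cell-wise consequence: a degree-`≤ D` corner cell kills every trace relation of degree `d ≤ D` -/

/-- THE TRACE-IDENTITY READING OF A CORNER CELL.  If every corner equation of border-rank type of degree `≤ D` vanishes
at `⟨n,n,n⟩` (the cell `(n, m)` of the degree axis `E` in corner form, `D = m^c`), then every trace relation
`Σ_σ c_σ Tr_σ` of degree `d ≤ D` valid on the tensors of rank `≤ m` has vanishing cycle-generating number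
`Σ_σ c_σ n^{cyc σ_κ + cyc σ_μ + cyc σ_ν} = 0`.  (Conversely — print, not kernel: by the Reynolds operator of the
reductive stabiliser `H_n ≅ GL_n³/torus` fixing `⟨n,n,n⟩` and the first fundamental theorem, these relations are ALL the
corner cell has to say [LandsbergGCT2017, Prop. 4.1.3.1, §8.3].) [cite: LandsbergGCT2017, §8.3.2 (p. 226); Lebruyn2008, p. 100] -/
theorem traceRelation_blind_of_cornerCell {m D : ℕ}
    (hcell : ∀ h : MvPolynomial ((Fin n × Fin n) × (Fin n × Fin n) × (Fin n × Fin n)) ℂ, h.totalDegree ≤ D →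
      h ∈ RV (Fin n × Fin n) (Fin n × Fin n) (Fin n × Fin n) m →
        MvPolynomial.aeval (fun p : (Fin n × Fin n) × (Fin n × Fin n) × (Fin n × Fin n) =>
          matMulTensor ℂ n n n p.1 p.2.1 p.2.2) h = 0)
    (hd : d ≤ D) (S : Finset (Equiv.Perm (Fin d) × Equiv.Perm (Fin d) × Equiv.Perm (Fin d)))
    (c : Equiv.Perm (Fin d) × Equiv.Perm (Fin d) × Equiv.Perm (Fin d) → ℂ)
    (hS : ∀ t : (Fin n × Fin n) → (Fin n × Fin n) → (Fin n × Fin n) → ℂ, tensorRank t ≤ m →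
      ∑ σ ∈ S, c σ * ∑ κ : Fin d → Fin n, ∑ μ : Fin d → Fin n, ∑ ν : Fin d → Fin n,
        ∏ s : Fin d, t (κ s, ν s) (κ (σ.1 s), μ s) (μ (σ.2.1 s), ν (σ.2.2 s)) = 0) :
    ∑ σ ∈ S, c σ * (n : ℂ) ^ ((σ.1.cycleFactorsFinset.card + (univ.filter fun x : Fin d => σ.1 x = x).card) +
        (σ.2.1.cycleFactorsFinset.card + (univ.filter fun x : Fin d => σ.2.1 x = x).card) +
        (σ.2.2.cycleFactorsFinset.card + (univ.filter fun x : Fin d => σ.2.2 x = x).card)) = 0 := by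
  rw [← aeval_matMul_traceRelation_eq_sum_pow]
  exact hcell _ ((totalDegree_traceRelation_le S c).trans hd) (traceRelation_mem_RV S c hS)

/-- The same with the value left as the counting product (no cycle count needed downstream). [bookkeeping] -/
theorem traceRelation_blind_of_cornerCell' {m D : ℕ}
    (hcell : ∀ h : MvPolynomial ((Fin n × Fin n) × (Fin n × Fin n) × (Fin n × Fin n)) ℂ, h.totalDegree ≤ D →
      h ∈ RV (Fin n × Fin n) (Fin n × Fin n) (Fin n × Fin n) m →
        MvPolynomial.aeval (fun p : (Fin n × Fin n) × (Fin n × Fin n) × (Fin n × Fin n) =>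
          matMulTensor ℂ n n n p.1 p.2.1 p.2.2) h = 0)
    (hd : d ≤ D) (S : Finset (Equiv.Perm (Fin d) × Equiv.Perm (Fin d) × Equiv.Perm (Fin d)))
    (c : Equiv.Perm (Fin d) × Equiv.Perm (Fin d) × Equiv.Perm (Fin d) → ℂ)
    (hS : ∀ t : (Fin n × Fin n) → (Fin n × Fin n) → (Fin n × Fin n) → ℂ, tensorRank t ≤ m →
      ∑ σ ∈ S, c σ * ∑ κ : Fin d → Fin n, ∑ μ : Fin d → Fin n, ∑ ν : Fin d → Fin n,
        ∏ s : Fin d, t (κ s, ν s) (κ (σ.1 s), μ s) (μ (σ.2.1 s), ν (σ.2.2 s)) = 0) :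
    MvPolynomial.aeval
        (fun p : (Fin n × Fin n) × (Fin n × Fin n) × (Fin n × Fin n) => matMulTensor ℂ n n n p.1 p.2.1 p.2.2)
      (∑ σ ∈ S, c σ • ∑ κ : Fin d → Fin n, ∑ μ : Fin d → Fin n, ∑ ν : Fin d → Fin n,
        ∏ s : Fin d, MvPolynomial.X (R := ℂ)
          (((κ s, ν s), (κ (σ.1 s), μ s), (μ (σ.2.1 s), ν (σ.2.2 s))) :
            (Fin n × Fin n) × (Fin n × Fin n) × (Fin n × Fin n))) = 0 :=
  hcell _ ((totalDegree_traceRelation_le S c).trans hd) (traceRelation_mem_RV S c hS)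

end Summit.MatrixMultiplication.MatrixMultiplication.Theorems.ObstructionDescentTraceDiagrams
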